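import Summits.QuantumFields.YangMills.Theorems.AllWindowsColdBoxBoxHighLineLandauThirdOrder
import Summits.QuantumFields.YangMills.Theorems.AllWindowsColdBoxBoxWindowHighSU2213OfSplit11

/-!
# After U5: ⟨stmt-QuantumFields-24336⟩ and ⟨stmt-QuantumFields-24004⟩ are EACH EQUIVALENT to the declared residual ⟨stmt-QuantumFields-25584⟩ — unconditionally

Planner ym-idea-2 g19 GO 2026-08-30T03:13:53Z («YES to the unconditional reductions»); LEAD seat ym-line-sfw-p2 g79 (free hands).
With the LOW window ✓p748001 `BoxWindowLowSU2213_proof` (S5, (1/16, 1/13]) and the MID window ✓p758295 `boxWindowMidSU221311_holds`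
(U5, (1/13, 1/11]; = ✓`Split11.boxWindowMidSU221311_of_sizes` at the two landed cut-set sizes ✓`tiltCum3_cutSet_size₀` / ✓`tiltCum4_cutSet_size`)
both tree theorems, the split glue ✓p757640 gives, with NO hypothesis left:

* `boxWindowHighSU2213_iff_high11 : Theses.AllWindowsColdBox.BoxWindowHighSU2213 ↔ Theses.AllWindowsColdBox.BoxWindowHighSU2211` — the HIGH item
  ⟨24336⟩ (θ > 1/13) IS the residual ⟨25584⟩ (θ > 1/11);
* `boxHighWindowsSU22_iff_high11 : Theses.AllWindowsColdBox.BoxHighWindowsSU22 ↔ Theses.AllWindowsColdBox.BoxWindowHighSU2211` — the parent crux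
  ⟨24004⟩ (all windows θ > 1/16) IS the residual ⟨25584⟩.

So the ONLY open mathematics under ⟨24004⟩/⟨24336⟩ is ⟨25584⟩ `BoxWindowHighSU2211` (θ > 1/11; RG/Bałaban class, attacked by no line) — and by
✓`LandauRung3.boxWindowHigh11_of_high` (full-reach file) even that reduces to the windows θ ≥ hi for any hi < 1/10.

HONEST LABEL: bookkeeping corollaries; nothing analytic is new; ⟨25584⟩, hence ⟨24336⟩ and ⟨24004⟩, remain OPEN; route AllWindowsColdBox DRAFT;
no rung or summit is proved; **the Yang–Mills mass gap is NOT proved by this file; no summit is proved by a line.**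
-/

set_option autoImplicit false

namespace Summit.QuantumFields.YangMills.Theorems.AllWindowsColdBoxBoxHighLine

namespace Split11

/-- ★ **⟨stmt-QuantumFields-24336⟩ ↔ ⟨stmt-QuantumFields-25584⟩**: after LOW ✓ and MID ✓, the HIGH item `BoxWindowHighSU2213` (θ > 1/13) holds
iff its declared residual `BoxWindowHighSU2211` (θ > 1/11) does. -/
theorem boxWindowHighSU2213_iff_high11 :
    Summit.QuantumFields.YangMills.Theses.AllWindowsColdBox.BoxWindowHighSU2213 ↔
      Summit.QuantumFields.YangMills.Theses.AllWindowsColdBox.BoxWindowHighSU2211 :=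
  ⟨boxWindowHighSU2211_of_high13,
    fun hhi => boxWindowHighSU2213_of_sizes_high11 tiltCum3_cutSet_size₀ tiltCum4_cutSet_size hhi⟩

/-- ★ **⟨stmt-QuantumFields-24004⟩ ↔ ⟨stmt-QuantumFields-25584⟩**: after LOW ✓ and MID ✓, the parent crux `BoxHighWindowsSU22` (θ > 1/16)
holds iff the residual `BoxWindowHighSU2211` (θ > 1/11) does. -/
theorem boxHighWindowsSU22_iff_high11 :
    Summit.QuantumFields.YangMills.Theses.AllWindowsColdBox.BoxHighWindowsSU22 ↔
      Summit.QuantumFields.YangMills.Theses.AllWindowsColdBox.BoxWindowHighSU2211 :=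
  ⟨fun h A θ hA hAθ h7 h11 => h A θ hA hAθ h7 (lt_trans (by norm_num) h11),
    fun hhi => boxHighWindowsSU22_of_sizes_high11 tiltCum3_cutSet_size₀ tiltCum4_cutSet_size hhi⟩

/-- Hence the two open items above the residual are equivalent to each other: ⟨24004⟩ ↔ ⟨24336⟩. -/
theorem boxHighWindowsSU22_iff_high13 :
    Summit.QuantumFields.YangMills.Theses.AllWindowsColdBox.BoxHighWindowsSU22 ↔
      Summit.QuantumFields.YangMills.Theses.AllWindowsColdBox.BoxWindowHighSU2213 :=
  boxHighWindowsSU22_iff_high11.trans boxWindowHighSU2213_iff_high11.symm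

end Split11

end Summit.QuantumFields.YangMills.Theorems.AllWindowsColdBoxBoxHighLine
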